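import Literature.Analysis.FluidPDE.PineauVicolPressureDuality
import Literature.Analysis.FluidPDE.LeraySelfSimilarCalculus
import Literature.Analysis.FluidPDE.AncientSimilarityVariables
import Mathlib.Analysis.Calculus.ContDiff.Bounds
import HarnessLib

/-!
# The pressure in Leray variables: dilation covariance and gradient bound (Pineau–Vicol 2026, Lemma 7.1)

Analysis/FluidPDE support file (all results proved; no named facts) in the discharge programme of
`Literature.Analysis.FluidPDE.pineauVicol2026_rdss_liouville` (B. Pineau, V. Vicol,
arXiv:2607.09619 (2026), Thm. 1.7). The self-similar pressure of Lemma 7.1 is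
`P = RᵢRⱼ(UⁱUʲ)` ("plus a function of time"); with the tree's pressure potential `Q` and the
physical identification `∇p(t) = ∇Q[u(t)]` (`PineauVicolPressureIdentification`), transporting
this to the Leray variables `V(s,y) = λ u(t, λy)`, `λ = e^{−s/2}`, needs the dilation covariance
`Q[λ v(λ·)](y) = λ² Q[v](λy)` (`pressurePotential_smul_comp_smul`), proved here on the decay class
from the cutoff-scale independence `pressurePotential_eq_scale_decay`, the kernel scalings
`newtonNear_scale`, `fderiv2_newtonFar_scale`, the scaling `∂ᵢ∂ⱼ(wᵢwⱼ) = λ⁴(∂ᵢ∂ⱼ(vᵢvⱼ))(λ·)` of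
the source (`pressureSource_smul_comp_smul`) and the change of variables `z ↦ λz`. The file also
records the gradient bound `‖∇Q[v](x)‖ ≤ K(B + C²(2+|x|)³)` on the decay class with a bounded
source gradient (`exists_bound_fderiv_pressurePotential`: `Γ₀ ∈ L¹` for the near part, the
decaying kernel `D³Γ∞` with Peetre's inequality for the far part) — the `∇P` input of (7.1) and
(7.10) of the source once the derivative bounds (7.2) are available; and the pointwise algebra
feeding it: `norm_iteratedFDeriv_two_convect_le`, `norm_fderiv_pressureSource_le`
(`‖∇(∂ᵢ∂ⱼ(vᵢvⱼ))‖ ≤ 12K²` for divergence-free `v` with `‖Dᵏv‖ ≤ K`, `k ≤ 3`),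
`norm_laplacian_le_three_mul`, and `norm_timeDerivWithin_le_of_leray` (`∂ₛV` from Leray's
momentum equation, the (7.1) input).

## References

* B. Pineau, V. Vicol, arXiv:2607.09619 (2026), Lemma 7.1 (proof, p. 24), Lemma 2.1.
  [PineauVicol2026]
-/

noncomputable section

open MeasureTheory Set Filter Metric Topology InnerProductSpace Function
open scoped RealInnerProductSpace Laplacian ContDiff ENNReal

namespace Literature.Analysis.FluidPDE

namespace PineauVicol2026

/-- Local notation for physical space `ℝ³ = EuclideanSpace ℝ (Fin 3)`. -/
local notation "ℝ³" => EuclideanSpace ℝ (Fin 3)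

open Literature.Analysis.FluidPDE.FourierNS (HasDecay)

-- nested operator types
set_option maxSynthPendingDepth 3

/-- **Scaling of the quadratic source**: for `w(z) = λ v(λ z)`,
`∂ᵢ∂ⱼ(wᵢwⱼ)(z) = λ⁴ ∂ᵢ∂ⱼ(vᵢvⱼ)(λ z)`. [folklore] -/
theorem pressureSource_smul_comp_smul (v : ℝ³ → ℝ³) (lam : ℝ) (z : ℝ³) :
    pressureSource (fun y => lam • v (lam • y)) z = lam ^ 4 * pressureSource v (lam • z) := by
  set F : ℝ³ → ℝ³ := fun x => FluidPDE.convect v v x + VectorCalculus.divergence v x • v x with hFdef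
  -- the field whose divergence is the source scales like `λ³ F(λ ·)`
  have hF : (fun y => FluidPDE.convect (fun y => lam • v (lam • y)) (fun y => lam • v (lam • y)) y +
      VectorCalculus.divergence (fun y => lam • v (lam • y)) y • (fun y => lam • v (lam • y)) y) =
      fun y => lam ^ 3 • F (lam • y) := by
    funext y
    simp only [hFdef, FluidPDE.convect_apply, fderiv_smul_comp_smul v lam y, divergence_smul_comp_smul v lam y,
      FunLike.coe_smul, Pi.smul_apply, map_smul, smul_add, smul_smul]
    congr 1 <;> ring_nf
  have hdiv : VectorCalculus.divergence (fun y => lam ^ 3 • F (lam • y)) z =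
      (lam ^ 3 * lam) * VectorCalculus.divergence F (lam • z) := by
    simp only [VectorCalculus.divergence, fderiv_const_smul_comp_smul' F (lam ^ 3) lam z,
      ContinuousLinearMap.toLinearMap_smul, map_smul, smul_eq_mul]
  have e1 : pressureSource (fun y => lam • v (lam • y)) z =
      VectorCalculus.divergence (fun y => lam ^ 3 • F (lam • y)) z := by
    rw [pressureSource, hF]
  have e2 : pressureSource v (lam • z) = VectorCalculus.divergence F (lam • z) := by
    rw [pressureSource]
  rw [e1, e2, hdiv]; ring

/-- **Dilation covariance of the pressure potential** on the decay class: for `v ∈ C²` with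
`(1+|y|)|v| ≤ C` and `λ > 0`, `Q[λ v(λ ·)](y) = λ² Q[v](λ y)` (the cutoff-scale independence
`pressurePotential_eq_scale_decay` at scale `λ`, the scalings of `Γ₀^{λ,2λ}`, `D²Γ∞^{λ,2λ}` and of
the source, and the change of variables `z ↦ λz`). In particular the Leray-variable pressure of a
Type I solution is the potential of the Leray-variable velocity, up to a function of time.
[folklore] -/
theorem pressurePotential_smul_comp_smul {v : ℝ³ → ℝ³} (hv2 : ContDiff ℝ 2 v) {C : ℝ}
    (hdec : ∀ y, ‖v y‖ ≤ C / (1 + ‖y‖)) {lam : ℝ} (hlam : 0 < lam) (y : ℝ³) :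
    pressurePotential (fun z => lam • v (lam • z)) y = lam ^ 2 * pressurePotential v (lam • y) := by
  have hd : Module.finrank ℝ ℝ³ = 3 := finrank_euclideanSpace_fin
  have hl3 : (lam ^ Module.finrank ℝ ℝ³)⁻¹ = lam⁻¹ ^ 3 := by rw [hd, inv_pow]
  -- the near part
  have hN : nearPotential 1 2 (fun z => lam • v (lam • z)) y =
      lam ^ 2 * nearPotential (lam * 1) (lam * 2) v (lam • y) := by
    rw [nearPotential, nearPotential]
    have e1 : ∀ z : ℝ³, newtonNear 1 2 z * pressureSource (fun z => lam • v (lam • z)) (y - z) =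
        lam ^ 5 * (fun z' => newtonNear (lam * 1) (lam * 2) z' * pressureSource v (lam • y - z')) (lam • z) := by
      intro z
      dsimp only
      rw [pressureSource_smul_comp_smul, newtonNear_scale hlam 1 2 (lam • z), smul_smul,
        inv_mul_cancel₀ hlam.ne', one_smul, ← smul_sub]
      field_simp
    simp_rw [e1]
    rw [integral_const_mul, Measure.integral_comp_smul_of_nonneg (μ := volume)
      (fun z' => newtonNear (lam * 1) (lam * 2) z' * pressureSource v (lam • y - z')) lam (hR := hlam.le), hl3,
      smul_eq_mul]
    field_simp
  -- the far part
  have hF : farPotential 1 2 (fun z => lam • v (lam • z)) y =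
      lam ^ 2 * farPotential (lam * 1) (lam * 2) v (lam • y) := by
    rw [farPotential, farPotential]
    have e1 : ∀ z : ℝ³, fderiv ℝ (fderiv ℝ (newtonFar 1 2)) (y - z) (lam • v (lam • z)) (lam • v (lam • z)) =
        lam ^ 5 * (fun z' => fderiv ℝ (fderiv ℝ (newtonFar (lam * 1) (lam * 2))) (lam • y - z') (v z') (v z')) (lam • z) := by
      intro z
      dsimp only
      rw [fderiv2_newtonFar_scale hlam 1 2, ← smul_sub, smul_smul, inv_mul_cancel₀ hlam.ne', one_smul]
      simp only [map_smul, FunLike.coe_smul, Pi.smul_apply, smul_eq_mul]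
      field_simp
    simp_rw [e1]
    rw [integral_const_mul, Measure.integral_comp_smul_of_nonneg (μ := volume)
      (fun z' => fderiv ℝ (fderiv ℝ (newtonFar (lam * 1) (lam * 2))) (lam • y - z') (v z') (v z')) lam (hR := hlam.le),
      hl3, smul_eq_mul]
    field_simp
  rw [pressurePotential_eq_scale_decay hlam hv2 hdec (lam • y), pressurePotential, hN, hF]
  ring

/-- **Gradient bound for the pressure potential** on the decay class with a bounded source
gradient: there is an absolute `K` such that for `v ∈ C³` with `(1+|y|)|v(y)| ≤ C` and
`‖∇(∂ᵢ∂ⱼ(vᵢvⱼ))‖ ≤ B`, `‖∇Q[v](x)‖ ≤ K (B + C² (2+|x|)³)` (near part: `Γ₀ ∈ L¹` against the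
source gradient; far part: `∫ D³Γ∞(x−y)(v,v)` with Peetre's inequality moving the kernel decay
onto the weight). [folklore] -/
theorem exists_bound_fderiv_pressurePotential :
    ∃ K : ℝ, 0 ≤ K ∧ ∀ (v : ℝ³ → ℝ³) (C B : ℝ), ContDiff ℝ 3 v → (∀ y, ‖v y‖ ≤ C / (1 + ‖y‖)) →
      0 ≤ B → (∀ y, ‖fderiv ℝ (pressureSource v) y‖ ≤ B) →
      ∀ x, ‖fderiv ℝ (pressurePotential v) x‖ ≤ K * (B + C ^ 2 * (2 + ‖x‖) ^ 3) := by
  obtain ⟨⟨M₀, hM₀⟩, ⟨M₁, hM₁⟩, -⟩ := exists_hasDecay_fderiv_newtonFar (r₀ := (1 : ℝ)) (r₁ := 2) one_pos one_lt_two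
  set N₁ : ℝ := ∫ z, |newtonNear (1 : ℝ) 2 (z : ℝ³)| with hN₁
  have hN₁0 : 0 ≤ N₁ := integral_nonneg fun z => abs_nonneg _
  set K₅ : ℝ := ∫ y : ℝ³, ((1 + ‖y‖) ^ 5)⁻¹ with hK₅
  have hK₅0 : 0 ≤ K₅ := integral_nonneg fun y => by positivity
  have hM₁0 := hM₁.nonneg
  refine ⟨max N₁ (M₁ * K₅), le_max_of_le_left hN₁0, fun v C B hv3 hdec hB hGB x => ?_⟩
  have hC : 0 ≤ C := by have := (norm_nonneg _).trans (hdec 0); simpa using this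
  -- regularity
  have hG1 : ContDiff ℝ 1 (pressureSource v) := contDiff_pressureSource (n := 1) (by exact_mod_cast hv3)
  have hnear1 : ContDiff ℝ 1 (nearPotential 1 2 v) := contDiff_nearPotential zero_le_one one_lt_two 1 (by exact_mod_cast hv3)
  have hfar2 := (contDiff_farPotential_decay one_pos one_lt_two hv3.continuous hdec).1
  have hfar1 : ContDiff ℝ 1 (farPotential 1 2 v) := hfar2.of_le one_le_two
  -- near part: `|∂ₐQ₁| ≤ N₁ B |a|`
  have hnear : ∀ a, ‖fderiv ℝ (nearPotential 1 2 v) x a‖ ≤ N₁ * B * ‖a‖ := by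
    intro a
    have e : nearPotential 1 2 v = fun x => ∫ z, newtonNear 1 2 z • pressureSource v (x - z) := by
      funext x; rfl
    rw [e, fderiv_integral_smul_comp_sub_apply (integrable_newtonNear zero_le_one one_lt_two)
      (fun z hz => newtonNear_eq_zero zero_le_one one_lt_two hz.le) hG1 x a]
    have hint : Integrable fun z => |newtonNear (1 : ℝ) 2 z| * (B * ‖a‖) :=
      (integrable_newtonNear zero_le_one one_lt_two).abs.mul_const _
    calc ‖∫ z, newtonNear 1 2 z • fderiv ℝ (pressureSource v) (x - z) a‖
        ≤ ∫ z, |newtonNear (1 : ℝ) 2 z| * (B * ‖a‖) := by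
          refine norm_integral_le_of_norm_le hint (Eventually.of_forall fun z => ?_)
          rw [smul_eq_mul, norm_mul, Real.norm_eq_abs]
          refine mul_le_mul_of_nonneg_left ?_ (abs_nonneg _)
          exact (ContinuousLinearMap.le_opNorm _ _).trans (mul_le_mul_of_nonneg_right (hGB _) (norm_nonneg _))
      _ = N₁ * B * ‖a‖ := by rw [integral_mul_const, hN₁]; ring
  -- far part: `|∂ₐQ₂| ≤ M₁ C² (2+|x|)³ K₅ |a|`
  have hfar : ∀ a, ‖fderiv ℝ (farPotential 1 2 v) x a‖ ≤ M₁ * K₅ * (C ^ 2 * (2 + ‖x‖) ^ 3) * ‖a‖ := by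
    intro a
    have hL := hasDecay_two_evalDiag hdec
    have hLc : Continuous fun y => evalDiag (v y) := continuous_evalDiag.comp hv3.continuous
    rw [farPotential_eq, fderiv_integral_clm_apply_comp_sub_apply_decay ((contDiff_fderiv2_newtonFar one_pos one_lt_two).of_le
      one_le_two) hM₀ hM₁ hLc hL x a]
    have hint : Integrable fun y : ℝ³ => M₁ * C ^ 2 * (2 + ‖x‖) ^ 3 * ((1 + ‖y‖) ^ 5)⁻¹ * ‖a‖ :=
      (integrable_inv_one_add_norm_pow_five.const_mul _).mul_const _
    calc ‖∫ y, evalDiag (v y) (fderiv ℝ (fderiv ℝ (fderiv ℝ (newtonFar 1 2))) (x - y) a)‖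
        ≤ ∫ y : ℝ³, M₁ * C ^ 2 * (2 + ‖x‖) ^ 3 * ((1 + ‖y‖) ^ 5)⁻¹ * ‖a‖ := by
          refine norm_integral_le_of_norm_le hint (Eventually.of_forall fun y => ?_)
          calc ‖evalDiag (v y) (fderiv ℝ (fderiv ℝ (fderiv ℝ (newtonFar 1 2))) (x - y) a)‖
              ≤ ‖evalDiag (v y)‖ * ‖fderiv ℝ (fderiv ℝ (fderiv ℝ (newtonFar 1 2))) (x - y) a‖ :=
                ContinuousLinearMap.le_opNorm _ _
            _ ≤ ‖evalDiag (v y)‖ * (‖fderiv ℝ (fderiv ℝ (fderiv ℝ (newtonFar 1 2))) (x - y)‖ * ‖a‖) := by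
                gcongr; exact ContinuousLinearMap.le_opNorm _ _
            _ = ‖evalDiag (v y)‖ * ‖fderiv ℝ (fderiv ℝ (fderiv ℝ (newtonFar 1 2))) (x - y)‖ * ‖a‖ := by ring
            _ ≤ M₁ * C ^ 2 * (2 + ‖x‖) ^ 3 * ((1 + ‖y‖) ^ 5)⁻¹ * ‖a‖ :=
                mul_le_mul_of_nonneg_right (norm_mul_norm_comp_sub_le hM₁ hL (by simp) y) (norm_nonneg _)
      _ = M₁ * K₅ * (C ^ 2 * (2 + ‖x‖) ^ 3) * ‖a‖ := by
          rw [integral_mul_const, integral_const_mul, hK₅]; ring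
  -- assemble
  have e : pressurePotential v = fun x => -nearPotential 1 2 v x - farPotential 1 2 v x := rfl
  have hdn := (hnear1.differentiable one_ne_zero) x
  have hdf := (hfar1.differentiable one_ne_zero) x
  have efd : fderiv ℝ (pressurePotential v) x = -fderiv ℝ (nearPotential 1 2 v) x - fderiv ℝ (farPotential 1 2 v) x := by
    rw [e]
    have h1 : HasFDerivAt (fun x => -nearPotential 1 2 v x - farPotential 1 2 v x)
        (-fderiv ℝ (nearPotential 1 2 v) x - fderiv ℝ (farPotential 1 2 v) x) x :=
      hdn.hasFDerivAt.neg.sub hdf.hasFDerivAt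
    exact h1.fderiv
  rw [efd]
  refine ContinuousLinearMap.opNorm_le_bound _ (by positivity) fun a => ?_
  show ‖-(fderiv ℝ (nearPotential 1 2 v) x a) - fderiv ℝ (farPotential 1 2 v) x a‖ ≤ _
  calc ‖-(fderiv ℝ (nearPotential 1 2 v) x a) - fderiv ℝ (farPotential 1 2 v) x a‖
      ≤ ‖fderiv ℝ (nearPotential 1 2 v) x a‖ + ‖fderiv ℝ (farPotential 1 2 v) x a‖ := by
        rw [← norm_neg (fderiv ℝ (nearPotential 1 2 v) x a)]; exact norm_sub_le _ _
    _ ≤ N₁ * B * ‖a‖ + M₁ * K₅ * (C ^ 2 * (2 + ‖x‖) ^ 3) * ‖a‖ := add_le_add (hnear a) (hfar a)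
    _ ≤ max N₁ (M₁ * K₅) * B * ‖a‖ + max N₁ (M₁ * K₅) * (C ^ 2 * (2 + ‖x‖) ^ 3) * ‖a‖ := by
        gcongr
        · exact le_max_left _ _
        · exact le_max_right _ _
    _ = max N₁ (M₁ * K₅) * (B + C ^ 2 * (2 + ‖x‖) ^ 3) * ‖a‖ := by ring

/-! ### The source gradient and `∂ₛV` under derivative bounds -/

/-- **`‖D²((v·∇)v)‖ ≤ 4K²`** when `‖Dᵏv‖ ≤ K` for `k ≤ 3` (Leibniz bound for the bilinear
evaluation `(A, u) ↦ A u`). [folklore] -/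
theorem norm_iteratedFDeriv_two_convect_le {v : ℝ³ → ℝ³} (hv : ContDiff ℝ 3 v) {K : ℝ}
    (hK : ∀ k ≤ 3, ∀ y, ‖iteratedFDeriv ℝ k v y‖ ≤ K) (y : ℝ³) :
    ‖iteratedFDeriv ℝ 2 (FluidPDE.convect v v) y‖ ≤ 4 * K ^ 2 := by
  have hK0 : 0 ≤ K := (norm_nonneg _).trans (hK 0 (by norm_num) y)
  -- `(v·∇)v = B(Dv, v)` with `B = id : (E →L E) →L (E →L E)`
  set B : (ℝ³ →L[ℝ] ℝ³) →L[ℝ] ℝ³ →L[ℝ] ℝ³ := ContinuousLinearMap.id ℝ (ℝ³ →L[ℝ] ℝ³) with hB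
  have hBn : ‖B‖ ≤ 1 := ContinuousLinearMap.norm_id_le
  have e : FluidPDE.convect v v = fun y => B (fderiv ℝ v y) (v y) := by
    funext y; rw [FluidPDE.convect_apply, hB, ContinuousLinearMap.id_apply]
  have hf : ContDiff ℝ 2 (fderiv ℝ v) := hv.fderiv_right (m := 2) (by norm_num)
  have hg : ContDiff ℝ 2 v := hv.of_le (by norm_num)
  rw [e]
  refine (B.norm_iteratedFDeriv_le_of_bilinear hf hg y (n := 2) le_rfl).trans ?_
  -- the three Leibniz terms
  have h0 : ‖iteratedFDeriv ℝ 0 (fderiv ℝ v) y‖ ≤ K := by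
    rw [norm_iteratedFDeriv_fderiv]; exact hK 1 (by norm_num) y
  have h1 : ‖iteratedFDeriv ℝ 1 (fderiv ℝ v) y‖ ≤ K := by
    rw [norm_iteratedFDeriv_fderiv]; exact hK 2 (by norm_num) y
  have h2 : ‖iteratedFDeriv ℝ 2 (fderiv ℝ v) y‖ ≤ K := by
    rw [norm_iteratedFDeriv_fderiv]; exact hK 3 le_rfl y
  have g0 : ‖iteratedFDeriv ℝ 0 v y‖ ≤ K := hK 0 (by norm_num) y
  have g1 : ‖iteratedFDeriv ℝ 1 v y‖ ≤ K := hK 1 (by norm_num) y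
  have g2 : ‖iteratedFDeriv ℝ 2 v y‖ ≤ K := hK 2 (by norm_num) y
  rw [Finset.sum_range_succ, Finset.sum_range_succ, Finset.sum_range_one]
  simp only [Nat.choose_zero_right, Nat.cast_one, one_mul, Nat.sub_zero, Nat.choose_one_right, Nat.cast_ofNat,
    Nat.choose_self]
  have t0 : ‖iteratedFDeriv ℝ 0 (fderiv ℝ v) y‖ * ‖iteratedFDeriv ℝ 2 v y‖ ≤ K * K :=
    mul_le_mul h0 g2 (norm_nonneg _) hK0
  have t1 : ‖iteratedFDeriv ℝ 1 (fderiv ℝ v) y‖ * ‖iteratedFDeriv ℝ 1 v y‖ ≤ K * K :=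
    mul_le_mul h1 g1 (norm_nonneg _) hK0
  have t2 : ‖iteratedFDeriv ℝ 2 (fderiv ℝ v) y‖ * ‖iteratedFDeriv ℝ 0 v y‖ ≤ K * K :=
    mul_le_mul h2 g0 (norm_nonneg _) hK0
  have hsum : ‖iteratedFDeriv ℝ 0 (fderiv ℝ v) y‖ * ‖iteratedFDeriv ℝ 2 v y‖ +
      2 * ‖iteratedFDeriv ℝ 1 (fderiv ℝ v) y‖ * ‖iteratedFDeriv ℝ 1 v y‖ +
      ‖iteratedFDeriv ℝ 2 (fderiv ℝ v) y‖ * ‖iteratedFDeriv ℝ 0 v y‖ ≤ 4 * K ^ 2 := by nlinarith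
  calc ‖B‖ * (‖iteratedFDeriv ℝ 0 (fderiv ℝ v) y‖ * ‖iteratedFDeriv ℝ 2 v y‖ +
        2 * ‖iteratedFDeriv ℝ 1 (fderiv ℝ v) y‖ * ‖iteratedFDeriv ℝ 1 v y‖ +
        ‖iteratedFDeriv ℝ 2 (fderiv ℝ v) y‖ * ‖iteratedFDeriv ℝ 0 v y‖)
      ≤ 1 * (4 * K ^ 2) := mul_le_mul hBn hsum (by positivity) zero_le_one
    _ = 4 * K ^ 2 := one_mul _

/-- **`‖∇(∂ᵢ∂ⱼ(vᵢvⱼ))‖ ≤ 12 K²`** for a divergence-free `v ∈ C³` with `‖Dᵏv‖ ≤ K`, `k ≤ 3`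
(`G = div((v·∇)v)`, the divergence as a trace sum over an orthonormal frame, and
`norm_iteratedFDeriv_two_convect_le`). [folklore] -/
theorem norm_fderiv_pressureSource_le {v : ℝ³ → ℝ³} (hv : ContDiff ℝ 3 v)
    (hdiv : VectorCalculus.IsDivFree v) {K : ℝ}
    (hK : ∀ k ≤ 3, ∀ y, ‖iteratedFDeriv ℝ k v y‖ ≤ K) (y : ℝ³) :
    ‖fderiv ℝ (pressureSource v) y‖ ≤ 12 * K ^ 2 := by
  set F : ℝ³ → ℝ³ := FluidPDE.convect v v with hF
  have hF2 : ContDiff ℝ 2 F := contDiff_convect_self (n := 2) (by exact_mod_cast hv)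
  have hDF : ContDiff ℝ 1 (fderiv ℝ F) := hF2.fderiv_right (m := 1) le_rfl
  have hD2 : ‖fderiv ℝ (fderiv ℝ F) y‖ ≤ 4 * K ^ 2 := by
    rw [← norm_iteratedFDeriv_one, norm_iteratedFDeriv_fderiv]
    exact norm_iteratedFDeriv_two_convect_le hv hK y
  -- the divergence as a trace sum
  set b := stdOrthonormalBasis ℝ ℝ³ with hb
  set T : Fin (Module.finrank ℝ ℝ³) → (ℝ³ →L[ℝ] ℝ³) →L[ℝ] ℝ :=
    fun i => (innerSL ℝ (b i)).comp (ContinuousLinearMap.apply ℝ ℝ³ (b i)) with hT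
  have hTn : ∀ i, ‖T i‖ ≤ 1 := fun i => by
    refine ContinuousLinearMap.opNorm_le_bound _ zero_le_one fun A => ?_
    rw [hT]; dsimp only
    rw [ContinuousLinearMap.comp_apply, ContinuousLinearMap.apply_apply, innerSL_apply_apply]
    calc ‖⟪b i, A (b i)⟫‖ ≤ ‖b i‖ * ‖A (b i)‖ := norm_inner_le_norm _ _
      _ ≤ ‖b i‖ * (‖A‖ * ‖b i‖) := by gcongr; exact A.le_opNorm _
      _ = 1 * ‖A‖ := by rw [b.orthonormal.1 i]; ring
  have eG : pressureSource v = fun y => ∑ i, T i (fderiv ℝ F y) := by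
    rw [pressureSource_eq_of_isDivFree hdiv]
    funext y
    rw [divergence_eq_sum_inner_fderiv b]
    simp only [hT, ContinuousLinearMap.comp_apply, ContinuousLinearMap.apply_apply, innerSL_apply_apply, hF]
  have hderiv : HasFDerivAt (pressureSource v) (∑ i, (T i).comp (fderiv ℝ (fderiv ℝ F) y)) y := by
    rw [eG]
    refine HasFDerivAt.fun_sum fun i _ => ?_
    exact (T i).hasFDerivAt.comp y ((hDF.differentiable one_ne_zero) y).hasFDerivAt
  rw [hderiv.fderiv]
  calc ‖∑ i, (T i).comp (fderiv ℝ (fderiv ℝ F) y)‖ ≤ ∑ i, ‖(T i).comp (fderiv ℝ (fderiv ℝ F) y)‖ :=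
        norm_sum_le _ _
    _ ≤ ∑ _i : Fin (Module.finrank ℝ ℝ³), 4 * K ^ 2 := by
        refine Finset.sum_le_sum fun i _ => ?_
        calc ‖(T i).comp (fderiv ℝ (fderiv ℝ F) y)‖ ≤ ‖T i‖ * ‖fderiv ℝ (fderiv ℝ F) y‖ :=
              ContinuousLinearMap.opNorm_comp_le _ _
          _ ≤ 1 * (4 * K ^ 2) := mul_le_mul (hTn i) hD2 (norm_nonneg _) zero_le_one
          _ = 4 * K ^ 2 := one_mul _
    _ = 12 * K ^ 2 := by
        rw [Finset.sum_const, Finset.card_univ, Fintype.card_fin, finrank_euclideanSpace_fin]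
        simp; ring

/-- **`‖Δf(x)‖ ≤ 3‖D²f(x)‖`** on `ℝ³` (the Laplacian as a trace over an orthonormal frame).
[folklore] -/
theorem norm_laplacian_le_three_mul {F : Type*} [NormedAddCommGroup F] [NormedSpace ℝ F]
    (f : ℝ³ → F) (x : ℝ³) : ‖(Δ f) x‖ ≤ 3 * ‖iteratedFDeriv ℝ 2 f x‖ := by
  set b := stdOrthonormalBasis ℝ ℝ³ with hb
  rw [laplacian_eq_iteratedFDeriv_orthonormalBasis f b]
  calc ‖∑ i, iteratedFDeriv ℝ 2 f x ![b i, b i]‖ ≤ ∑ i, ‖iteratedFDeriv ℝ 2 f x ![b i, b i]‖ :=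
        norm_sum_le _ _
    _ ≤ ∑ _i : Fin (Module.finrank ℝ ℝ³), ‖iteratedFDeriv ℝ 2 f x‖ := Finset.sum_le_sum fun i _ => by
        refine (ContinuousMultilinearMap.le_opNorm _ _).trans ?_
        rw [Fin.prod_univ_two]
        simp only [Matrix.cons_val_zero, Matrix.cons_val_one, b.orthonormal.1 i, mul_one]
        rfl
    _ = 3 * ‖iteratedFDeriv ℝ 2 f x‖ := by
        rw [Finset.sum_const, Finset.card_univ, Fintype.card_fin, finrank_euclideanSpace_fin]; simp

/-- **`∂ₛV` from Leray's momentum equation**: for a solution of the backward Leray system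
(`ν = 1`), `‖∂ₛV(s,y)‖ ≤ 3‖D²V‖ + ½‖V‖ + ½‖DV‖|y| + ‖DV‖‖V‖ + ‖∇P‖` at `(s, y)`. [folklore] -/
theorem norm_timeDerivWithin_le_of_leray {S : Set ℝ} {V : ℝ → ℝ³ → ℝ³} {P : ℝ → ℝ³ → ℝ}
    (h : IsBackwardLeraySolutionOn S 1 V P) {s : ℝ} (hs : s ∈ S) (y : ℝ³) :
    ‖FluidPDE.timeDerivWithin S V s y‖ ≤ 3 * ‖iteratedFDeriv ℝ 2 (V s) y‖ + (1 / 2) * ‖V s y‖ +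
      (1 / 2) * (‖fderiv ℝ (V s) y‖ * ‖y‖) + ‖fderiv ℝ (V s) y‖ * ‖V s y‖ + ‖gradient (P s) y‖ := by
  have hm := h.momentum_leray hs y
  rw [one_smul] at hm
  have h1 : ‖(Δ (V s)) y‖ ≤ 3 * ‖iteratedFDeriv ℝ 2 (V s) y‖ := norm_laplacian_le_three_mul _ _
  have h2 : ‖(1 / 2 : ℝ) • V s y‖ = (1 / 2) * ‖V s y‖ := by
    rw [norm_smul, Real.norm_of_nonneg (by norm_num)]
  have h3 : ‖(1 / 2 : ℝ) • fderiv ℝ (V s) y y‖ ≤ (1 / 2) * (‖fderiv ℝ (V s) y‖ * ‖y‖) := by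
    rw [norm_smul, Real.norm_of_nonneg (by norm_num)]
    exact mul_le_mul_of_nonneg_left (ContinuousLinearMap.le_opNorm _ _) (by norm_num)
  have h4 : ‖FluidPDE.convect (V s) (V s) y‖ ≤ ‖fderiv ℝ (V s) y‖ * ‖V s y‖ := by
    rw [FluidPDE.convect_apply]; exact ContinuousLinearMap.le_opNorm _ _
  -- `td = ΔV - a - b - c - g`
  set td := FluidPDE.timeDerivWithin S V s y with htd
  set a := (1 / 2 : ℝ) • V s y with ha
  set b := (1 / 2 : ℝ) • fderiv ℝ (V s) y y with hb
  set c := FluidPDE.convect (V s) (V s) y with hc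
  set g := gradient (P s) y with hg
  set L := (Δ (V s)) y with hL
  clear_value td a b c g L
  have e : td = L - a - b - c - g := by
    rw [← hm]; abel
  rw [e]
  have s1 := norm_sub_le (L - a - b - c) g
  have s2 := norm_sub_le (L - a - b) c
  have s3 := norm_sub_le (L - a) b
  have s4 := norm_sub_le L a
  linarith

end PineauVicol2026

end Literature.Analysis.FluidPDE
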